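import Literature.MathematicalPhysics.QuantumLattice.HubbardFermiLiquid
import HarnessLib

/-!
# The 1D repulsive Hubbard model is a Luttinger liquid at weak coupling (Mastropietro 2005,
# Thm. 1): the two-point Schwinger function in the limit `L, β → ∞`

Trunk T-QLATTICE (`Literature/MathematicalPhysics/QuantumLattice`); cite item `wi-67926` (BC5 /
tribunal-T3 sibling witness for crux `KLRegimeTwoPointLimit` of the planned route KLProgramme, cell
gate-hubbard-kl).  ONE new named fact (`mastropietro_1d_two_point_limit`), one definition
(`hubbardThermalTwoPoint1D`), no theorem of the source is claimed proved here.

**Source, quoted.**  V. Mastropietro, *Rigorous proof of Luttinger liquid behavior in the 1d Hubbard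
model*, J. Stat. Phys. 121 (2005) 373–432 (arXiv:cond-mat/0502415, held as
`paper:arxiv-cond-mat_0502415`).  p. 3, (1.1): `H = -t Σ_{x∈Λ} Σ_σ (a⁺_{x,σ}a⁻_{x+1,σ} + a⁺_{x+1,σ}a⁻_{x,σ})
+ U Σ_x a⁺_{x,+}a⁻_{x,+}a⁺_{x,-}a⁻_{x,-} - μ Σ_{x,σ} a⁺_{x,σ}a⁻_{x,σ}`, "where `Λ` is an interval of `L`
points on the one dimensional lattice […] periodic boundary conditions; `t = 1/2` is the hopping
parameter, `U > 0` the coupling and `μ` the chemical potential"; `<X>_{L,β} = Tr e^{-βH} X / Tr e^{-βH}`,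
the Schwinger functions `S_{L,β}(𝐱₁,ε₁,σ₁;…) = <a^{ε₁}_{𝐱₁,σ₁} ⋯>_{L,β}`, "We will denote by `S(…)` the
`lim_{L,β→∞}`", and the two point Schwinger function `S_{L,β}(𝐱,+,σ;𝐲,-,σ) = S_{L,β}(𝐱,𝐲)` (sf11).
p. 4, **Theorem 1.** "Consider the hamiltonian (1.1) with `-1 < μ < 1` and `μ ≠ 0` (not filled or
half filled band case); there exists an `ε > 0` such that, for `0 < U < ε` a) the two point Schwinger
function (sf11) is given by, in the limit `L, β → ∞`,
`S(𝐱,𝐲) = Σ_{ω=±} e^{iω p_F (x-y)} / (v(x₀-y₀) + iω(x-y)) · (1 + A_ω(𝐱,𝐲)) / |𝐱-𝐲|^η + S̄(𝐱,𝐲)` (1.3aa)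
with `η = aU² + U²f₀(U)`, `p_F = cos⁻¹ μ + f₁(U)`, `v = v₀ + f₂(U)` where `a > 0`, `|fᵢ(U)| ≤ CU` […]
Moreover the occupation number `n_k` is continuous at `k = ± p_F` but its first derivative diverges
[…]" — a Luttinger liquid.  p. 11, **Lemma 1** (the sign-resolved marginal flow): "For `U > 0` and
small enough the flow is given by, for any `h`, `|g_{2,h} - g_{2,0} - g_{1,0}/2| ≤ U^{3/2}`,
`|g_{4,h} - g_{4,0}| ≤ U^{3/2}`, `0 < g_{1,h} ≤ g_{1,0} / (1 - a/3 g_{1,0} h)`."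
The limit convention of this school is made explicit in Benfatto–Falco–Mastropietro, CMP 330 (2014),
(1.12): "`lim_{β,L→∞} ≡ lim_{β→∞} lim_{L→∞}`" (thermodynamic limit first, then zero temperature).

## What is vendored (faithful, typeable part)

As for `bgm_two_point_limit` (`HubbardFermiLiquid.lean`, the `d = 2` pattern): the tree has honest
finite-volume Gibbs states of the Hubbard Hamiltonian on the discrete torus `(ℤ/Lℤ)^d` for every `d`
(`hubbardTorusWith d L t U μ`, `thermalCorr`), but no infinite-volume Schwinger functions, so the
Luttinger form (1.3aa) is recorded in prose only.  The typeable shadow `mastropietro_1d_two_point_limit`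
is the EXISTENCE of the iterated limit `lim_{β→∞} lim_{L→∞}` of the finite-volume equal-time
two-point function `<a⁺_{x,σ} a⁻_{y,σ}>_{L,β}` (the `x₀ = y₀` case of (sf11)) in Mastropietro's regime,
typed literally as: the `L → ∞` limits exist for all sufficiently large `β` and converge as `β → ∞`.

TYPIST CAVEAT (recorded for the requester): Thm. 1 is printed for the limit `L, β → ∞`; the
existence of the fixed-`β` limit `L → ∞` for EVERY `β > 0` is part of the multiscale construction
(`β` = infrared cutoff at scale `h_β`, loc. cit. §2–3; finite temperature explicitly in
Benfatto–Falco–Mastropietro 2014 §1–2) but is not a printed clause of Thm. 1, so it is NOT asserted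
here (the inner limits are asserted eventually in `β`, exactly what the iterated limit presupposes).

**Conversion of conventions.**  The tree's `hubbardTorusWith 1 L 1 U μ` has hopping `t = 1`
(dispersion `-2 cos k - μ`, band `[-2, 2]`, half filling `μ = 0`); Mastropietro's (1.1) has `t = 1/2`
(dispersion `-cos k - μ_M`).  Thus `H_M(μ_M, U_M) = ½ · H_tree(μ, U)` with `μ = 2μ_M`, `U = 2U_M`, and
`e^{-β_M H_M} = e^{-(β_M/2) H_tree}`; the hypotheses `-1 < μ_M < 1`, `μ_M ≠ 0`, `0 < U_M < ε` become
`-2 < μ < 2`, `μ ≠ 0`, `0 < U < U₀ := 2ε`, and the rescaling of `β` is immaterial for `β → ∞`.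

## References

* [Mastropietro2005] V. Mastropietro, J. Stat. Phys. 121 (2005) 373–432, Thm. 1 (p. 4), Lemma 1
  (p. 11); doi:10.1007/s10955-005-7007-0.
* [BenfattoFalcoMastropietro2014] G. Benfatto, P. Falco, V. Mastropietro, CMP 330 (2014) 153–215,
  (1.12) (limit convention) and Thm. 1.1.
-/

noncomputable section

open Filter Topology Matrix
open Literature.MathematicalPhysics.QuantumLattice Literature.Probability.LatticeModels

namespace Literature.MathematicalPhysics.QuantumLattice

/-- The finite-volume thermal (equal-time) two-point function `<a⁺_{x,σ} a⁻_{y,σ'}>_{L,β}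
= Tr(e^{-βH} a⁺_{xσ} a⁻_{yσ'}) / Tr e^{-βH}` of the ONE-dimensional Hubbard model (hopping `1`,
coupling `U`, chemical potential `μ`) on the ring `ℤ/Lℤ`, at lattice sites `x, y ∈ ℤ` projected to the
ring (junk `0` for `L = 0`) — `hubbardThermalTwoPoint` with `Site 2 ↦ Site 1`.
[cite: Mastropietro2005, §1.2 (Def), (sf), (sf11) (p. 3)] -/
def hubbardThermalTwoPoint1D (β U μ : ℝ) (L : ℕ) (x y : Site 1) (σ σ' : Fin 2) : ℂ :=
  if hL : L = 0 then 0
  else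
    haveI : NeZero L := ⟨hL⟩
    thermalCorr β (hubbardTorusWith 1 L 1 U μ)
      (creation (orb (FermionTorus.ofTorusSite (Torus.proj L x)) σ))
      (annihilation (orb (FermionTorus.ofTorusSite (Torus.proj L y)) σ'))

/-- **Mastropietro 2005, Thm. 1 — typeable shadow (existence of the iterated limit
`lim_{β→∞} lim_{L→∞}` of the two-point function of the 1D repulsive Hubbard model at weak coupling,
away from half filling).**  In the tree's convention (hopping `t = 1`): for every chemical potential
`-2 < μ < 2`, `μ ≠ 0`, there is `U₀ > 0` such that for every coupling `0 < U < U₀`, every pair of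
sites `x, y ∈ ℤ` and spin `σ`, the finite-volume equal-time two-point functions
`<a⁺_{x,σ} a⁻_{y,σ}>_{L,β}` have limits `S_β` as `L → ∞` for all sufficiently large `β`, and
`S_β → S` as `β → ∞`.  (Thm. 1 as printed gives, in this regime and "in the limit `L, β → ∞`" —
read `lim_β lim_L`, [cite: BenfattoFalcoMastropietro2014, (1.12)] — the Luttinger-liquid form (1.3aa)
of the limit with anomalous exponent `η = aU² + O(U³)`; prose only, see the module docstring.  The
fixed-`β` limit for every `β > 0` is NOT asserted here, see TYPIST CAVEAT.)
[cite: Mastropietro2005, Thm. 1 (p. 4)] -/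
def mastropietro_1d_two_point_limit : Prop :=
  ∀ μ : ℝ, -2 < μ → μ < 2 → μ ≠ 0 → ∃ U₀ : ℝ, 0 < U₀ ∧
    ∀ U : ℝ, 0 < U → U < U₀ →
      ∀ (x y : Site 1) (σ : Fin 2), ∃ (Sβ : ℝ → ℂ) (S : ℂ),
        (∀ᶠ β in atTop,
          Tendsto (fun L : ℕ => hubbardThermalTwoPoint1D β U μ L x y σ σ) atTop (𝓝 (Sβ β))) ∧
        Tendsto Sβ atTop (𝓝 S)

/-! ### API -/

/-- The junk value at `L = 0` of the finite-volume two-point function (sf11). [cite: Mastropietro2005, §1.2 (sf11) (p. 3)] -/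
@[simp] theorem hubbardThermalTwoPoint1D_zero (β U μ : ℝ) (x y : Site 1) (σ σ' : Fin 2) :
    hubbardThermalTwoPoint1D β U μ 0 x y σ σ' = 0 := by
  simp [hubbardThermalTwoPoint1D]

/-- Unfolding for `L ≠ 0`: `<a⁺_{xσ} a⁻_{yσ'}>_{L,β} = Tr(e^{-βH} a⁺ a⁻)/Tr e^{-βH}` on the ring `ℤ/Lℤ`.
[cite: Mastropietro2005, §1.2 (Def), (sf11) (p. 3)] -/
theorem hubbardThermalTwoPoint1D_of_ne_zero (β U μ : ℝ) {L : ℕ} (hL : L ≠ 0) (x y : Site 1)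
    (σ σ' : Fin 2) :
    hubbardThermalTwoPoint1D β U μ L x y σ σ' =
      (haveI : NeZero L := ⟨hL⟩
       thermalCorr β (hubbardTorusWith 1 L 1 U μ)
        (creation (orb (FermionTorus.ofTorusSite (Torus.proj L x)) σ))
        (annihilation (orb (FermionTorus.ofTorusSite (Torus.proj L y)) σ'))) := by
  simp [hubbardThermalTwoPoint1D, hL]

/-- The admissible `μ`-range is nonempty on both sides of half filling: e.g. `μ = ± 1`
(Mastropietro's `μ_M = ± 1/2`). [cite: Mastropietro2005, Thm. 1 (p. 4)] -/
example : (-2 : ℝ) < 1 ∧ (1 : ℝ) < 2 ∧ (1 : ℝ) ≠ 0 ∧ (-2 : ℝ) < -1 ∧ (-1 : ℝ) < 2 ∧ (-1 : ℝ) ≠ 0 := by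
  norm_num

end Literature.MathematicalPhysics.QuantumLattice
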